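import Literature.Combinatorics.SimpleGraph.HyperellipticInvolution
import HarnessLib

/-!
# Weierstrass points of a graph; fixed points of the hyperelliptic involution (Baker–Norine
# 2009, §5.5: definition, Remark 63, and two steps of the proof of Theorem 65)

Source (held, read at the page; statements VERBATIM). M. Baker, S. Norine, *Harmonic morphisms
and hyperelliptic graphs*, Int. Math. Res. Not. IMRN 2009, no. 15, 2914–2955 [BakerNorine2009]
(held text `paper:arxiv-0707.1309`, chunk p0021). §5.5: «Recall from [BakerSpecialization] that,
by analogy with the theory of Riemann surfaces, a vertex `x ∈ V(G)` is called a Weierstrass point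
if `r(g(x)) ≥ 1`.» **Remark 63.** «On a hyperelliptic Riemann surface `X`, the Weierstrass points
are precisely the fixed points of the hyperelliptic involution. For a 2-edge-connected graph `G`,
it is easy to see that a fixed point of the hyperelliptic involution is a Weierstrass point, and
if `g(G) = 2` then the converse also holds. However, if `g(G) ≥ 3` then the converse does not
always hold […].» Proof of **Theorem 65** (steps): «Note that for every `t ∈ V(T)` we have
`r(φ^*((t))) = 1`. If `m_φ(x) = 2` for some `x ∈ V(G)`, then `x` is a Weierstrass point, as
`r(g(x)) ≥ r(2(x)) = r(φ^*(φ(x))) = 1`. […] Consider a vertex `t ∈ V(T)` with `deg(t) = 1`. Let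
`φ^{-1}(t) = {x, x′}`, and let `x″` be the unique neighbor of `x` in `V(G) ∖ φ^{-1}(t)` […]. It is
easy to see that there are `v_φ(x) + 1` edges incident to `x`, namely the `v_φ(x)` vertical edges
connecting `x` to `x′` and the horizontal edge connecting `x` to `x″`. Also, since `G` is
2-edge-connected, we have `deg(x) ≥ 2` […]. It follows that
`(v_φ(x) + 2)(x) ∼ (x) + v_φ(x)(x′) + (x″) ≥ (x) + (x′) = φ^*(t)`. Therefore
`r((v_φ(x) + 2)(x)) ≥ 1`, and `x` is a Weierstrass point of `G` if
`v_φ(x) ≤ g − 2`.» The definition is from M. Baker, *Specialization of linear systems from curves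
to graphs*, Algebra & Number Theory 2 (2008) 613–653 = arXiv:math/0701075 ([BakerSpecialization] of
the source; cited through [BakerNorine2009]).

## What is formalised (simple graphs; vocabulary of `HyperellipticInvolution`: the hyperelliptic
## involution = a tree involution `ι` — `IsInvolutiveAut`, `(quotientGraph G ι).IsTree`,
## `HasSimpleEdgeOrbits`; `g(x)` = the divisor `Pi.single x (genus G)`)

* `IsWeierstrassPoint G x` («`r(g(x)) ≥ 1`»); monotonicity `r(D) ≤ r(D + E)` for effective `E`;
  `r(2(x)) ≥ 1 ⟹ x` Weierstrass (`g ≥ 2`) — the step «`r(g(x)) ≥ r(2(x))`»;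
* **Remark 63**: a fixed point of the tree involution is a Weierstrass point; for `g = 2` the
  converse («if `g(G) = 2` then the converse also holds»);
* the second step of the proof of Theorem 65 in the simple-graph case (`v_φ(x) = 1`): if `x ∼ ι(x)`
  and `deg(x) ≤ 2` then `3(x) ∼ (3 − deg x)(x) + Σ_{u ∼ x}(u) ≥ (x) + (ι x)`, so `r(3(x)) ≥ 1` and
  `x` is a Weierstrass point when `g ≥ 3`.
The classification Theorem 65 itself (the multigraphs `B_n`, `B(l₁,l₂,l₃)`, `Φ(l)`) is not typed.

One definition with body and theorems; no `sorry`; no named facts.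
-/

open Finset SimpleGraph Matrix
open Literature.Combinatorics.SimpleGraph.ChipFiring

namespace Literature.Combinatorics.SimpleGraph.BakerNorine

universe u

variable {V : Type u} [Fintype V] [DecidableEq V] (G : SimpleGraph V) [DecidableRel G.Adj]

/-! ### §1 Weierstrass points -/

/-- **Weierstrass point**: «a vertex `x ∈ V(G)` is called a Weierstrass point if `r(g(x)) ≥ 1`»
(`g(x)` = `g` chips on `x`). [cite: BakerNorine2009, §5.5 (from [BakerSpecialization])] -/
def IsWeierstrassPoint (x : V) : Prop := 1 ≤ rank G (Pi.single x (genus G))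

/-- Unfolding `IsWeierstrassPoint`. [cite: BakerNorine2009, §5.5] -/
theorem isWeierstrassPoint_iff (x : V) :
    IsWeierstrassPoint G x ↔ 1 ≤ rank G (Pi.single x (genus G)) := Iff.rfl

variable {G}

/-- `r(D) ≤ r(D + E)` for effective `E` (Lemma 2 with `r(E) ≥ 0`, or trivially if `r(D) = −1`).
[cite: BakerNorine2009, §1.3 (Lemma 2) and §5.5 («`r(g(x)) ≥ r(2(x))`»)] -/
theorem rank_le_rank_add_of_nonneg [Nonempty V] (D : V → ℤ) {E : V → ℤ} (hE : 0 ≤ E) :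
    rank G D ≤ rank G (D + E) := by
  rcases eq_or_lt_of_le (neg_one_le_rank G D) with h | h
  · rw [← h]
    exact neg_one_le_rank G _
  · have hE' : 0 ≤ rank G E := (rank_nonneg_iff G E).2 (winnable_of_nonneg G hE)
    have := rank_add_le_rank_add G (D := D) (D' := E) (by omega) hE'
    omega

omit [Fintype V] [DecidableRel G.Adj] in
/-- `2(x) = (x) + (x)`. [cite: BakerNorine2009, §1.3] -/
theorem single_two_eq (x : V) : (Pi.single x 2 : V → ℤ) = Pi.single x 1 + Pi.single x 1 := by
  funext z
  simp only [Pi.add_apply, Pi.single_apply]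
  split_ifs <;> rfl

/-- `r(k(x)) ≥ 1` with `k ≤ g` makes `x` a Weierstrass point (`r(g(x)) ≥ r(k(x))`, as
`g(x) − k(x) ≥ 0`).
[cite: BakerNorine2009, Theorem 65 (proof: «`r((v_φ(x) + 2)(x)) ≥ 1`, and `x` is a Weierstrass
point of `G` if `v_φ(x) ≤ g − 2`»)] -/
theorem isWeierstrassPoint_of_rank_single (hG : G.Connected) {k : ℤ} (hk : k ≤ genus G) {x : V}
    (h : 1 ≤ rank G (Pi.single x k)) : IsWeierstrassPoint G x := by
  haveI : Nonempty V := hG.nonempty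
  rw [isWeierstrassPoint_iff]
  have hsplit : (Pi.single x (genus G) : V → ℤ) = Pi.single x k + Pi.single x (genus G - k) := by
    funext z
    simp only [Pi.add_apply, Pi.single_apply]
    split_ifs <;> ring
  have hE : (0 : V → ℤ) ≤ Pi.single x (genus G - k) := fun z => by
    simp only [Pi.zero_apply, Pi.single_apply]
    split_ifs <;> omega
  rw [hsplit]
  exact h.trans (rank_le_rank_add_of_nonneg _ hE)

/-- «`r(g(x)) ≥ r(2(x))`»: a vertex with `r(2(x)) ≥ 1` is a Weierstrass point (`g ≥ 2`).
[cite: BakerNorine2009, Theorem 65 (proof: «`x` is a Weierstrass point, as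
`r(g(x)) ≥ r(2(x)) = … = 1`»)] -/
theorem isWeierstrassPoint_of_rank_single_two (hG : G.Connected) (hg : 2 ≤ genus G) {x : V}
    (h : 1 ≤ rank G (Pi.single x 2)) : IsWeierstrassPoint G x :=
  isWeierstrassPoint_of_rank_single hG hg h

/-! ### §2 Firing a vertex from `3(x)` -/

/-- Firing `x` once from `3(x)`: `3(x) ∼ (3 − deg x)(x) + Σ_{u ∼ x}(u)` («`(v_φ(x) + 2)(x) ∼
(x) + v_φ(x)(x′) + (x″)`», with `v_φ(x) = 1` in a simple graph).
[cite: BakerNorine2009, Theorem 65 (proof)] -/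
theorem linEquiv_single_three_fire (x : V) :
    LinEquiv G (Pi.single x 3)
      (fun z => if z = x then 3 - (G.degree x : ℤ) else if G.Adj x z then 1 else 0) := by
  rw [linEquiv_iff_exists_eq_sub]
  refine ⟨charFun {x}, funext fun z => ?_⟩
  by_cases hz : z = x
  · subst hz
    rw [if_pos rfl, sub_mulVec_charFun_apply_of_mem G _ (Finset.mem_singleton_self z),
      Pi.single_eq_same]
    rw [Finset.sdiff_singleton_eq_erase, Finset.erase_eq_of_notMem (G.notMem_neighborFinset_self z),
      card_neighborFinset_eq_degree]
  · rw [if_neg hz, sub_mulVec_charFun_apply_of_not_mem G _ (by rwa [Finset.mem_singleton]),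
      Pi.single_eq_of_ne hz, zero_add]
    by_cases hadj : G.Adj x z
    · rw [if_pos hadj]
      have : G.neighborFinset z ∩ {x} = {x} :=
        Finset.inter_singleton_of_mem ((mem_neighborFinset _ _ _).2 hadj.symm)
      rw [this, Finset.card_singleton]
      rfl
    · rw [if_neg hadj]
      have : G.neighborFinset z ∩ {x} = ∅ :=
        Finset.inter_singleton_of_notMem fun h => hadj ((mem_neighborFinset _ _ _).1 h).symm
      rw [this, Finset.card_empty]
      rfl

/-! ### §3 Remark 63: fixed points of the hyperelliptic involution -/

section TreeInvolution

variable (hG : G.Connected) (h2 : G.IsEdgeConnected 2) {ι : V → V} (hι : IsInvolutiveAut G ι)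
  (hT : (quotientGraph G ι).IsTree) (hs : HasSimpleEdgeOrbits G ι)
include hG h2 hι hT hs

/-- **Remark 63**: «a fixed point of the hyperelliptic involution is a Weierstrass point»
(`(x) + (ι x) = 2(x)` has `r = 1` by Corollary 53; `g ≥ 2`). [cite: BakerNorine2009, Remark 63] -/
theorem isWeierstrassPoint_of_fixed (hg : 2 ≤ genus G) {x : V} (hx : ι x = x) :
    IsWeierstrassPoint G x := by
  have hV := two_lt_card_of_two_le_genus hG hg
  refine isWeierstrassPoint_of_rank_single_two hG hg ?_
  have h1 := rank_pair_eq_one_of_isTree_quotientGraph hG h2 hV hι hT hs hg x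
  rw [hx, ← single_two_eq] at h1
  omega

/-- **Remark 63**: «if `g(G) = 2` then the converse also holds» — in genus `2` a Weierstrass point
is fixed by the hyperelliptic involution (`r(2(x)) ≥ 1 ⟹ r((x) + (x)) = 1 ⟹ x = ι(x)` by
Remark 56). [cite: BakerNorine2009, Remark 63] -/
theorem fixed_of_isWeierstrassPoint_of_genus_eq_two (hg : genus G = 2) {x : V}
    (hx : IsWeierstrassPoint G x) : ι x = x := by
  have hV := two_lt_card_of_two_le_genus hG hg.symm.le
  rw [isWeierstrassPoint_iff, hg, single_two_eq] at hx
  have hr : rank G (Pi.single x 1 + Pi.single x 1) = 1 :=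
    (rank_eq_one_iff_of_sum_eq_two hG hg.symm.le (sum_single_add_single x x)).2 hx
  exact (eq_apply_of_rank_pair_eq_one hG h2 hV hι hT hs hg.symm.le hr).symm

/-- **Remark 63** in genus `2`: the Weierstrass points are exactly the fixed points of the
hyperelliptic involution. [cite: BakerNorine2009, Remark 63] -/
theorem isWeierstrassPoint_iff_fixed_of_genus_eq_two (hg : genus G = 2) (x : V) :
    IsWeierstrassPoint G x ↔ ι x = x :=
  ⟨fixed_of_isWeierstrassPoint_of_genus_eq_two hG h2 hι hT hs hg,
    isWeierstrassPoint_of_fixed hG h2 hι hT hs hg.symm.le⟩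

/-! ### §4 A step of the proof of Theorem 65: vertices of degree two adjacent to their image -/

/-- **Theorem 65 (proof step)**: if `x ∼ ι(x)` and `deg(x) ≤ 2` then `r(3(x)) ≥ 1`
(«`r((v_φ(x) + 2)(x)) ≥ 1`»: `3(x) ∼ (3 − deg x)(x) + Σ_{u∼x}(u) ≥ (x) + (ι x)`, whose rank is `1`).
[cite: BakerNorine2009, Theorem 65 (proof)] -/
theorem one_le_rank_single_three (hg : 2 ≤ genus G) {x : V} (hx : G.Adj x (ι x))
    (hdeg : G.degree x ≤ 2) : 1 ≤ rank G (Pi.single x 3) := by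
  haveI : Nonempty V := hG.nonempty
  have hV := two_lt_card_of_two_le_genus hG hg
  have h1 := rank_pair_eq_one_of_isTree_quotientGraph hG h2 hV hι hT hs hg x
  rw [(linEquiv_single_three_fire (G := G) x).rank_eq]
  -- the fired divisor dominates `(x) + (ι x)`
  set F : V → ℤ := fun z => if z = x then 3 - (G.degree x : ℤ) else if G.Adj x z then 1 else 0
    with hF
  have hιx : ι x ≠ x := fun h => by rw [h] at hx; exact G.irrefl hx
  have hle : (0 : V → ℤ) ≤ F - (Pi.single x 1 + Pi.single (ι x) 1) := fun z => by
    rw [Pi.zero_apply, Pi.sub_apply, single_add_single_apply, hF]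
    dsimp only
    by_cases hz : z = x
    · rw [if_pos hz, if_pos hz, if_neg (by rw [hz]; exact Ne.symm hιx)]
      omega
    · rw [if_neg hz, if_neg hz]
      by_cases hz' : z = ι x
      · rw [if_pos (by rw [hz']; exact hx), if_pos hz']
        norm_num
      · rw [if_neg hz']
        split_ifs <;> omega
  have := rank_le_rank_add_of_nonneg (G := G) (Pi.single x 1 + Pi.single (ι x) 1) hle
  rw [add_sub_cancel] at this
  omega

/-- **Theorem 65 (proof step)**: such a vertex is a Weierstrass point when `g ≥ 3` («`x` is a
Weierstrass point of `G` if `v_φ(x) ≤ g − 2`», `v_φ(x) = 1`). [cite: BakerNorine2009, Theorem 65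
(proof)] -/
theorem isWeierstrassPoint_of_adj_of_degree_le_two (hg : 3 ≤ genus G) {x : V} (hx : G.Adj x (ι x))
    (hdeg : G.degree x ≤ 2) : IsWeierstrassPoint G x :=
  isWeierstrassPoint_of_rank_single hG hg
    (one_le_rank_single_three hG h2 hι hT hs (by omega) hx hdeg)

end TreeInvolution

end Literature.Combinatorics.SimpleGraph.BakerNorine
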